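import Summits.HubbardSuperconductivity.HubbardSuperconductivity.Theorems.DeformationLadderLadderThesisNormalForms
import Literature.MathematicalPhysics.QuantumLattice.HubbardLSMFillingProofs

/-!
# Route `DeformationLadder`, crux `LowEnergyRigidity` (`stmt-HubbardSuperconductivity-1892`):
# energy cost of the `q`-fold charge twist and the twisted test states

Support file (`--supports stmt-HubbardSuperconductivity-1892`), part 2/3 of the TWIST CEILING
`R_L(s) = minEnergyOn (H_L + (s/L⁴)Δ_dᴴΔ_d) − minEnergyOn H_L ≤ C·s^{2/3}` (proved in
`…TwistCeiling`, with the weight bound of `…TwistWeight`). Here: the KINETIC side.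

* `cos_twistPhase_sub_succ`, `abs_cos_twistPhase_sub_one_le` — across a bond along `e₁` the phases
  `2π(q·x₁ mod L)/L` differ by `∓2π q̄/L (mod 2π)`, so `|cos Δθ − 1| ≤ 1 − cos(2π q̄/L)` (`q̄ = q.val`);
* `re_expect_lsmPerturbation_twist_le` — the Lieb–Schultz–Mattis perturbation of the spin-`↑`
  charge twist `θ_q` costs `Re⟨φ, P_{θ_q} φ⟩ ≤ 8π² q̄² |t| ⟨φ,φ⟩` on the `L × L` torus
  (`≤ 4L²` ordered bonds × `|t|(1 − cos(2π q̄/L)) ≤ 2π² q̄²|t|/L²`);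
* `re_expect_twist_add_re_expect_twist_neg` — LSM averaging:
  `Re⟨U_ϑψ, HU_ϑψ⟩ + Re⟨U_ϑ⁻¹ψ, HU_ϑ⁻¹ψ⟩ = 2Re⟨ψ,Hψ⟩ + 2Re⟨ψ,P_ϑψ⟩` for `H = hubbardTorus 2 L t U`;
* `fockTwist_mulVec_mem_szSector`, `star_fockTwist_mulVec_dotProduct_self`,
  `exists_unit_groundState_hubbardTorus` — twisted sector ground states are admissible unit test
  vectors of the `(2n, 0)` sector.

The twist angles are carried as a family `θ` with defining hypothesis `hθ` (as in `…TwistWeight`).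
Sources: Lieb–Schultz–Mattis, Ann. Phys. 16 (1961) 407, App. B; Tasaki, J. Stat. Phys. 170 (2018)
653, §2.2; Lieb, PRL 62 (1989) 1201 (sector ground states). Finite-dimensional linear algebra.
-/

set_option linter.dupNamespace false

noncomputable section

namespace Summit.HubbardSuperconductivity.HubbardSuperconductivity.Theorems.DeformationLadder

open Matrix Complex Literature.MathematicalPhysics.QuantumLattice Literature.Probability.LatticeModels
  HubbardWave0
open Summit.HubbardSuperconductivity.HubbardSuperconductivity.Theses.DeformationLadder
open scoped Matrix.Norms.L2Operator ComplexOrder ComplexConjugate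

/-! ### The energy cost of the `q`-fold twist (Lieb–Schultz–Mattis) -/

section Cost

variable {L : ℕ} [NeZero L]

/-- The twist phases of two sites adjacent along `e₁` differ by `∓2π q/L` modulo `2π`:
`cos(2π (q·a mod L)/L − 2π (q·(a+1) mod L)/L) = cos(2π q̄/L)`, `q̄` the representative of `q`. [folklore] -/
theorem cos_twistPhase_sub_succ (q a : ZMod L) :
    Real.cos (2 * Real.pi * (((q * a).val : ℕ) : ℝ) / L - 2 * Real.pi * (((q * (a + 1)).val : ℕ) : ℝ) / L) =
      Real.cos (2 * Real.pi * (q.val : ℝ) / L) := by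
  have hL : (L : ℝ) ≠ 0 := by exact_mod_cast (NeZero.ne L)
  set m : ℕ := (q * a).val + q.val with hm
  have hval : (((q * (a + 1)).val : ℕ) : ℝ) = (m : ℝ) - (L : ℝ) * ((m / L : ℕ) : ℝ) := by
    have h1 : (q * (a + 1)).val = m % L := by rw [mul_add, mul_one, ZMod.val_add]
    have h2 : ((m % L : ℕ) : ℝ) + (L : ℝ) * ((m / L : ℕ) : ℝ) = (m : ℝ) := by
      exact_mod_cast Nat.mod_add_div m L
    rw [h1]; linarith
  rw [hval, hm]
  push_cast
  have : 2 * Real.pi * (((q * a).val : ℕ) : ℝ) / L -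
      2 * Real.pi * ((((q * a).val : ℕ) : ℝ) + (q.val : ℝ) - (L : ℝ) * ((m / L : ℕ) : ℝ)) / L =
      -(2 * Real.pi * (q.val : ℝ) / L) + ((m / L : ℕ) : ℝ) * (2 * Real.pi) := by
    field_simp
    ring
  rw [this, Real.cos_add_nat_mul_two_pi, Real.cos_neg]

/-- **Bond bound for the `q`-fold twist**: if `a ≡ b`, `b ≡ a + 1` or `a ≡ b + 1` in `ℤ/Lℤ` then
`|cos(2π(q·a mod L)/L − 2π(q·b mod L)/L) − 1| ≤ 1 − cos(2π q̄/L)`. (`q̄ = 1`: `abs_cos_sub_one_le_of_rel`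
of `HubbardLSMFillingProofs`.) Lieb–Schultz–Mattis (1961), App. B. [folklore] -/
theorem abs_cos_twistPhase_sub_one_le (q a b : ZMod L) (h : a = b ∨ b = a + 1 ∨ a = b + 1) :
    |Real.cos (2 * Real.pi * (((q * a).val : ℕ) : ℝ) / L - 2 * Real.pi * (((q * b).val : ℕ) : ℝ) / L) - 1| ≤
      1 - Real.cos (2 * Real.pi * (q.val : ℝ) / L) := by
  have hcos1 : Real.cos (2 * Real.pi * (q.val : ℝ) / L) ≤ 1 := Real.cos_le_one _
  rcases h with rfl | rfl | rfl
  · rw [sub_self, Real.cos_zero, sub_self, abs_zero]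
    linarith
  · rw [cos_twistPhase_sub_succ, abs_of_nonpos (by linarith)]
    linarith
  · rw [← Real.cos_neg, neg_sub, cos_twistPhase_sub_succ, abs_of_nonpos (by linarith)]
    linarith

variable (θ : ZMod L → Orb (FermionTorus 2 L) → ℝ)
  (hθ : ∀ (q : ZMod L) (k : Orb (FermionTorus 2 L)), θ q k = if (ofLex k).2 = 0 then
    2 * Real.pi * ((((q * FermionTorus.toTorusSite (ofLex k).1 0).val : ℕ) : ℝ)) / L else 0)
include hθ

omit [NeZero L] in
/-- The twist angle vanishes on the spin-`↓` orbital of every site `x`. [folklore] -/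
theorem twistAngle_orb_one (q : ZMod L) (x : FermionTorus 2 L) : θ q (orb x 1) = 0 := by
  rw [hθ]
  simp

omit [NeZero L] in
/-- The twist angle on the spin-`↑` orbital of a fermionic-torus site `x`. [folklore] -/
theorem twistAngle_orb_zero (q : ZMod L) (x : FermionTorus 2 L) :
    θ q (orb x 0) = 2 * Real.pi * (((q * FermionTorus.toTorusSite x 0).val : ℕ) : ℝ) / L := by
  rw [hθ]
  simp only [ofLex_toLex, if_true]

/-- **Energy cost of the `q`-fold spin-`↑` twist on the `L × L` torus.** The Lieb–Schultz–Mattis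
perturbation `P_θ = -T(cos(θ_u − θ_v) − 1)` of the twist `θ_q` (by which the mean energy of
`U_{±θ_q}ψ` exceeds `⟨H⟩_ψ`, `fockTwist_conj_hamiltonianWith_add`) satisfies
`Re⟨φ, P_θ φ⟩ ≤ 8π² q̄² |t| ⟨φ, φ⟩`: each of the `≤ 4L²` ordered bonds costs at most
`|t|(1 − cos(2π q̄/L)) ≤ 2π² q̄² |t|/L²` (only spin `↑` is twisted). Lieb–Schultz–Mattis, Ann. Phys. 16
(1961) 407, App. B; Tasaki, J. Stat. Phys. 170 (2018) 653, §2.2. [folklore] -/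
theorem re_expect_lsmPerturbation_twist_le (q : ZMod L) (t : ℝ) (φ : Fock (Orb (FermionTorus 2 L))) :
    (star φ ⬝ᵥ lsmPerturbation (fermionTorusGraph 2 L) (θ q) t *ᵥ φ).re ≤
      8 * Real.pi ^ 2 * (q.val : ℝ) ^ 2 * |t| * (star φ ⬝ᵥ φ).re := by
  have hL : L ≠ 0 := NeZero.ne L
  have hL' : (L : ℝ) ≠ 0 := by exact_mod_cast hL
  have hnn : 0 ≤ (star φ ⬝ᵥ φ).re := by
    rw [Matrix.star_dotProduct_self_re]; positivity
  refine (re_expect_lsmPerturbation_le (fermionTorusGraph 2 L) (θ q) t φ).trans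
    (mul_le_mul_of_nonneg_right ?_ hnn)
  -- termwise bound on a bond
  have hbond : ∀ u v : FermionTorus 2 L, (fermionTorusGraph 2 L).Adj u v →
      (∑ τ : Fin 2, |Real.cos (θ q (orb u τ) - θ q (orb v τ)) - 1|) ≤
        1 - Real.cos (2 * Real.pi * (q.val : ℝ) / L) := by
    intro u v huv
    rw [Fin.sum_univ_two, twistAngle_orb_one θ hθ, twistAngle_orb_one θ hθ, sub_self,
      Real.cos_zero, sub_self, abs_zero, add_zero, twistAngle_orb_zero θ hθ,
      twistAngle_orb_zero θ hθ]
    refine abs_cos_twistPhase_sub_one_le q _ _ ?_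
    have h := coord_rel_of_adj (0 : Fin 2) huv
    simp only [FermionTorus.toTorusSite_apply]
    rcases h with h | h | h
    · exact Or.inl h
    · exact Or.inr (Or.inl (by rw [h]; push_cast; ring))
    · exact Or.inr (Or.inr (by rw [h]; push_cast; ring))
  have hc : 0 ≤ 1 - Real.cos (2 * Real.pi * (q.val : ℝ) / L) := by
    linarith [Real.cos_le_one (2 * Real.pi * (q.val : ℝ) / L)]
  have hsum : (∑ u : FermionTorus 2 L, ∑ v : FermionTorus 2 L,
      if (fermionTorusGraph 2 L).Adj u v then
        ∑ τ : Fin 2, |Real.cos (θ q (orb u τ) - θ q (orb v τ)) - 1| else 0) ≤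
      (L : ℝ) ^ 2 * (2 * (2 : ℕ)) * (1 - Real.cos (2 * Real.pi * (q.val : ℝ) / L)) := by
    refine le_trans ?_ (sum_sum_adj_const_le hc)
    refine Finset.sum_le_sum fun u _ => Finset.sum_le_sum fun v _ => ?_
    split_ifs with huv
    · exact hbond u v huv
    · exact le_rfl
  -- `1 - cos x ≤ x² / 2`
  have hcos : 1 - Real.cos (2 * Real.pi * (q.val : ℝ) / L) ≤
      2 * Real.pi ^ 2 * (q.val : ℝ) ^ 2 / (L : ℝ) ^ 2 := by
    have h := Real.one_sub_sq_div_two_le_cos (x := 2 * Real.pi * (q.val : ℝ) / L)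
    have : (2 * Real.pi * (q.val : ℝ) / L) ^ 2 / 2 = 2 * Real.pi ^ 2 * (q.val : ℝ) ^ 2 / (L : ℝ) ^ 2 := by
      field_simp
    linarith
  calc |t| * (∑ u : FermionTorus 2 L, ∑ v : FermionTorus 2 L,
        if (fermionTorusGraph 2 L).Adj u v then
          ∑ τ : Fin 2, |Real.cos (θ q (orb u τ) - θ q (orb v τ)) - 1| else 0)
      ≤ |t| * ((L : ℝ) ^ 2 * (2 * (2 : ℕ)) * (1 - Real.cos (2 * Real.pi * (q.val : ℝ) / L))) :=
        mul_le_mul_of_nonneg_left hsum (abs_nonneg t)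
    _ ≤ |t| * ((L : ℝ) ^ 2 * (2 * (2 : ℕ)) * (2 * Real.pi ^ 2 * (q.val : ℝ) ^ 2 / (L : ℝ) ^ 2)) :=
        mul_le_mul_of_nonneg_left (mul_le_mul_of_nonneg_left hcos (by positivity)) (abs_nonneg t)
    _ = 8 * Real.pi ^ 2 * (q.val : ℝ) ^ 2 * |t| := by
        field_simp
        push_cast
        ring

omit [NeZero L] hθ in
/-- **Lieb–Schultz–Mattis averaging identity for the Hubbard torus**: for every twist `ϑ` and
vector `ψ`, `Re⟨U_ϑψ, H U_ϑψ⟩ + Re⟨U_ϑ⁻¹ψ, H U_ϑ⁻¹ψ⟩ = 2Re⟨ψ, Hψ⟩ + 2Re⟨ψ, P_ϑ ψ⟩`,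
`H = hubbardTorus 2 L t U` (`U_ϑ H U_ϑ⁻¹ + U_ϑ⁻¹ H U_ϑ = 2H + 2P_ϑ`, `fockTwist_conj_hamiltonianWith_add`).
Lieb–Schultz–Mattis, Ann. Phys. 16 (1961) 407, App. B, eq. (B-5). [folklore] -/
theorem re_expect_twist_add_re_expect_twist_neg (t U : ℝ) (ϑ : Orb (FermionTorus 2 L) → ℝ)
    (ψ : Fock (Orb (FermionTorus 2 L))) :
    (star (fockTwist ϑ *ᵥ ψ) ⬝ᵥ hubbardTorus 2 L t U *ᵥ (fockTwist ϑ *ᵥ ψ)).re +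
        (star (fockTwist (-ϑ) *ᵥ ψ) ⬝ᵥ hubbardTorus 2 L t U *ᵥ (fockTwist (-ϑ) *ᵥ ψ)).re =
      2 * (star ψ ⬝ᵥ hubbardTorus 2 L t U *ᵥ ψ).re +
        2 * (star ψ ⬝ᵥ lsmPerturbation (fermionTorusGraph 2 L) ϑ t *ᵥ ψ).re := by
  have key : fockTwist (-ϑ) * hubbardTorus 2 L t U * fockTwist ϑ +
      fockTwist ϑ * hubbardTorus 2 L t U * fockTwist (-ϑ) =
      (2 : ℂ) • hubbardTorus 2 L t U + (2 : ℂ) • lsmPerturbation (fermionTorusGraph 2 L) ϑ t := by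
    rw [add_comm]
    have h := fockTwist_conj_hamiltonianWith_add (fermionTorusGraph 2 L) ϑ t U 0
    rw [hamiltonianWith_zero] at h
    exact h
  rw [Matrix.star_mulVec_dotProduct_mulVec, Matrix.star_mulVec_dotProduct_mulVec,
    conjTranspose_fockTwist, conjTranspose_fockTwist, neg_neg, ← Complex.add_re, ← dotProduct_add,
    ← Matrix.add_mulVec, key, Matrix.add_mulVec, Matrix.smul_mulVec, Matrix.smul_mulVec,
    dotProduct_add, dotProduct_smul, dotProduct_smul, Complex.add_re]
  simp only [smul_eq_mul, Complex.mul_re, Complex.re_ofNat, Complex.im_ofNat, zero_mul, sub_zero]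

end Cost

/-! ### Test states: twisted ground states stay in the sector and keep their norm -/

section TestStates

variable {L : ℕ} [NeZero L]

omit [NeZero L] in
/-- A Fock-space phase twist (diagonal in the occupation basis) preserves every joint sector
`(N, S^z) = (2n, 0)`. [folklore] -/
theorem fockTwist_mulVec_mem_szSector (ϑ : Orb (FermionTorus 2 L) → ℝ) {n : ℕ}
    {v : Fock (Orb (FermionTorus 2 L))} (hv : v ∈ szSector (Λ := FermionTorus 2 L) (2 * n) 0) :
    fockTwist ϑ *ᵥ v ∈ szSector (Λ := FermionTorus 2 L) (2 * n) 0 := by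
  rw [mem_szSector_two_mul_zero_iff] at hv ⊢
  intro s hs
  rw [fockTwist_mulVec_apply, hv s hs, mul_zero]

omit [NeZero L] in
/-- A phase twist preserves the norm: `⟨U_ϑ v, U_ϑ v⟩ = ⟨v, v⟩`. [folklore] -/
theorem star_fockTwist_mulVec_dotProduct_self (ϑ : Orb (FermionTorus 2 L) → ℝ)
    (v : Fock (Orb (FermionTorus 2 L))) :
    star (fockTwist ϑ *ᵥ v) ⬝ᵥ (fockTwist ϑ *ᵥ v) = star v ⬝ᵥ v :=
  Matrix.star_mulVec_dotProduct_self_of_unitary (conjTranspose_fockTwist_mulVec_mulVec ϑ) v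

omit [NeZero L] in
/-- **Unit sector ground states of the pure Hubbard torus exist** whenever the sector
`(2n, 0)` contains a unit vector: a unit `ψ₀ ∈ szSector (2n) 0` with `H ψ₀ = E₀ ψ₀`,
`E₀ = minEnergyOn H (szSector (2n) 0)`, `Re⟨ψ₀, Hψ₀⟩ = E₀` (`sector_groundState`).
Lieb, PRL 62 (1989) 1201; Tasaki (2020) §2.2. [folklore] -/
theorem exists_unit_groundState_hubbardTorus (U : ℝ) {n : ℕ}
    (hK : ∃ ψ ∈ szSector (Λ := FermionTorus 2 L) (2 * n) 0, star ψ ⬝ᵥ ψ = 1) :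
    ∃ ψ₀ ∈ szSector (Λ := FermionTorus 2 L) (2 * n) 0, star ψ₀ ⬝ᵥ ψ₀ = 1 ∧
      (star ψ₀ ⬝ᵥ hubbardTorus 2 L 1 U *ᵥ ψ₀).re =
        (hubbardTorus 2 L 1 U).minEnergyOn (szSector (Λ := FermionTorus 2 L) (2 * n) 0) := by
  classical
  obtain ⟨ψ₁, hψ₁K, hψ₁⟩ := hK
  have hH : (hubbardTorus 2 L 1 U).IsHermitian := by
    simpa using isHermitian_hubbardTorusWith L 1 U 0
  have hPS : PreservesSectors (hubbardTorus 2 L 1 U) :=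
    LiebThm1.preservesSectors_hamiltonian (fermionTorusGraph 2 L) 1 U
  have hKiff : ∀ v : Fock (Orb (FermionTorus 2 L)), v ∈ szSector (2 * n) (0 : ℝ) ↔
      ∀ s, ¬((upPart s).card = n ∧ (downPart s).card = n) → v s = 0 :=
    fun v => mem_szSector_two_mul_zero_iff n v
  have hp : ∃ s : Finset (Orb (FermionTorus 2 L)), (upPart s).card = n ∧ (downPart s).card = n := by
    by_contra hno
    push Not at hno
    have h0 : ψ₁ = 0 := funext fun s => (hKiff ψ₁).1 hψ₁K s (fun h => hno s h.1 h.2)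
    rw [h0, dotProduct_zero] at hψ₁
    exact zero_ne_one hψ₁
  have hinv : ∀ s s' : Finset (Orb (FermionTorus 2 L)),
      ¬((upPart s).card = n ∧ (downPart s).card = n) →
      ((upPart s').card = n ∧ (downPart s').card = n) → hubbardTorus 2 L 1 U s s' = 0 := by
    intro s s' hs hs'
    by_contra h
    have := hPS s s' h
    exact hs ⟨this.1.trans hs'.1, this.2.trans hs'.2⟩
  obtain ⟨⟨v, hv, hv0, hAv⟩, -⟩ := sector_groundState (hubbardTorus 2 L 1 U) hH
    (fun s => (upPart s).card = n ∧ (downPart s).card = n) hp hinv (szSector (2 * n) 0) hKiff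
  obtain ⟨c, hc, hc1⟩ := exists_smul_unit hv0
  refine ⟨c • v, Submodule.smul_mem _ c hv, hc1, ?_⟩
  rw [mulVec_smul, hAv, smul_comm, dotProduct_smul, hc1, smul_eq_mul, mul_one, Complex.ofReal_re]

end TestStates

end Summit.HubbardSuperconductivity.HubbardSuperconductivity.Theorems.DeformationLadder
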